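import Summits.Ventures.CertifiedArithmetic.LowPrec.Accumulate
import Literature.ComputerArithmetic.JeannerodRump2018.Summation

/-!
# Any-order floating-point summation in a format: the height bound (R2, trees: pairwise, blocked)

HONEST FRAMING (venture CertifiedArithmetic / cell `pub-lowprec`): certified error envelopes and
provably optimal rounding/accumulation schemes for low-precision formats under stated cost models;
every table by two implementations; no hardware or vendor claims.

An evaluation ORDER of `Σ xᵢ` is a binary tree (`SumTree` of the typed Jeannerod–Rump file); its
floating-point evaluation in format `α` is `SumTree.eval fl` with `fl t = (roundNE α t).toRat`
(RNE, every internal node one rounding). PROVED here for every `α` with `emaxCode ≥ 2`: if the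
leaves are values of `α` and every node's exact argument stays in range, then
`|ŝ - s| ≤ ((1 + u_α)^h - 1) · Σ |xᵢ|`, `h` = height of the tree (`abs_eval_sub_exact_le_height`).
Sequential order has `h = n - 1` (Higham (4.4), cf. `Accumulate.lean`); PAIRWISE summation has
`h = ⌈log₂ n⌉` (Higham [Higham2002ASNA, §4.2 eq. (4.6)]); blocked orders compose heights. The
standard model with gradual underflow is discharged by `exists_delta_fadd` (Accumulate.lean); no
`(1+δ)` hypothesis remains.
-/

namespace Literature.ComputerArithmetic.FloatingPoint

namespace MiniFloat

open Literature.ComputerArithmetic.JeannerodRump2018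
open Literature.ComputerArithmetic.JeannerodRump2018.SumTree

variable {α : Format}

/-- Height of an evaluation tree (a leaf has height `0`; = number of roundings on the longest
path). [cite: Higham2002ASNA, §4.2] -/
def treeHeight : SumTree → ℕ
  | .leaf _ => 0
  | .node l r => max (treeHeight l) (treeHeight r) + 1

/-- `Σ |xᵢ|` over the leaves. [folklore] -/
def absLeafSum : SumTree → ℚ
  | .leaf x => |x|
  | .node l r => absLeafSum l + absLeafSum r

/-- The floating-point evaluation map of format `α`: round-to-nearest-even (saturating), as a map
on values. [folklore] -/
def flα (α : Format) (t : ℚ) : ℚ := (roundNE α t).toRat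

/-- Every internal node of the tree, evaluated in `α`, has an in-range exact argument and a
representable result feeding upward; leaves are values of `α`. [folklore] -/
def TreeInRange (α : Format) : SumTree → Prop
  | .leaf x => ∃ y : MiniFloat α, y.toRat = x
  | .node l r => TreeInRange α l ∧ TreeInRange α r ∧
      |SumTree.eval (flα α) l + SumTree.eval (flα α) r| ≤ α.maxRat

/-- Every evaluated subtree is the value of some datum of `α`. [folklore] -/
theorem exists_toRat_eq_eval (t : SumTree) (h : TreeInRange α t) :
    ∃ y : MiniFloat α, y.toRat = SumTree.eval (flα α) t := by
  cases t with
  | leaf x => exact h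
  | node l r => exact ⟨roundNE α _, rfl⟩

/-- `absLeafSum` is nonnegative. [folklore] -/
theorem absLeafSum_nonneg : ∀ t : SumTree, 0 ≤ absLeafSum t
  | .leaf x => abs_nonneg x
  | .node l r => add_nonneg (absLeafSum_nonneg l) (absLeafSum_nonneg r)

/-- The exact sum is bounded by `Σ|xᵢ|`. [folklore] -/
theorem abs_exact_le_absLeafSum : ∀ t : SumTree, |SumTree.exact t| ≤ absLeafSum t
  | .leaf x => le_rfl
  | .node l r => by
      simp only [SumTree.exact, absLeafSum]
      exact le_trans (abs_add_le _ _) (add_le_add (abs_exact_le_absLeafSum l) (abs_exact_le_absLeafSum r))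

/-- R2 FOR ANY EVALUATION ORDER (height form): leaves in `F_α`, every node in range, `emaxCode ≥ 2`
⟹ `|ŝ - s| ≤ ((1+u)^h - 1) · Σ|xᵢ|` with `h` the height of the evaluation tree
(pairwise summation: `h = ⌈log₂ n⌉`). [cite: Higham2002ASNA, §4.2 eq. (4.6)] -/
theorem abs_eval_sub_exact_le_height (hα : 2 ≤ α.emaxCode) :
    ∀ t : SumTree, TreeInRange α t →
      |SumTree.eval (flα α) t - SumTree.exact t|
        ≤ ((1 + α.unitRoundoff) ^ treeHeight t - 1) * absLeafSum t
  | .leaf x, _ => by simp [SumTree.eval, SumTree.exact, treeHeight]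
  | .node l r, ⟨hl, hr, hrange⟩ => by
      have hu := α.unitRoundoff_pos
      have ihl := abs_eval_sub_exact_le_height hα l hl
      have ihr := abs_eval_sub_exact_le_height hα r hr
      obtain ⟨yl, hyl⟩ := exists_toRat_eq_eval l hl
      obtain ⟨yr, hyr⟩ := exists_toRat_eq_eval r hr
      -- the node rounding in model form
      have hrange' : |yl.toRat + yr.toRat| ≤ α.maxRat := by rw [hyl, hyr]; exact hrange
      obtain ⟨δ, hδ, hδle⟩ := exists_delta_fadd hα yl yr hrange'
      rw [← hyl] at ihl
      rw [← hyr] at ihr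
      simp only [SumTree.eval, SumTree.exact, treeHeight, absLeafSum]
      rw [show flα α (SumTree.eval (flα α) l + SumTree.eval (flα α) r)
          = (roundNE α (yl.toRat + yr.toRat)).toRat by rw [flα, hyl, hyr], hδ]
      set el := yl.toRat - SumTree.exact l with hel
      set er := yr.toRat - SumTree.exact r with her
      set Al := absLeafSum l
      set Ar := absLeafSum r
      have hAl := absLeafSum_nonneg l
      have hAr := absLeafSum_nonneg r
      have hsl := abs_exact_le_absLeafSum l
      have hsr := abs_exact_le_absLeafSum r
      have hd := abs_le.mp hδle
      -- heights: children have height ≤ H := max, so their factors are ≤ (1+u)^H - 1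
      set H := max (treeHeight l) (treeHeight r) with hH
      have hpl : (1 + α.unitRoundoff) ^ treeHeight l ≤ (1 + α.unitRoundoff) ^ H :=
        pow_le_pow_right₀ (by linarith) (le_max_left _ _)
      have hpr : (1 + α.unitRoundoff) ^ treeHeight r ≤ (1 + α.unitRoundoff) ^ H :=
        pow_le_pow_right₀ (by linarith) (le_max_right _ _)
      have ihl' : |el| ≤ ((1 + α.unitRoundoff) ^ H - 1) * Al :=
        le_trans ihl (mul_le_mul_of_nonneg_right (by linarith) hAl)
      have ihr' : |er| ≤ ((1 + α.unitRoundoff) ^ H - 1) * Ar :=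
        le_trans ihr (mul_le_mul_of_nonneg_right (by linarith) hAr)
      have hP : (1 : ℚ) ≤ (1 + α.unitRoundoff) ^ H := one_le_pow₀ (by linarith)
      -- key identity
      have key : (yl.toRat + yr.toRat) * (1 + δ) - (SumTree.exact l + SumTree.exact r)
          = (el + er) * (1 + δ) + δ * (SumTree.exact l + SumTree.exact r) := by
        rw [hel, her]; ring
      rw [key]
      have h1 : |(el + er) * (1 + δ)| ≤ ((1 + α.unitRoundoff) ^ H - 1) * (Al + Ar) * (1 + α.unitRoundoff) := by
        rw [abs_mul]
        apply mul_le_mul (le_trans (abs_add_le _ _) (by linarith)) _ (abs_nonneg _) (by nlinarith)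
        rw [abs_le]; constructor <;> linarith
      have h2 : |δ * (SumTree.exact l + SumTree.exact r)| ≤ α.unitRoundoff * (Al + Ar) := by
        rw [abs_mul]
        exact mul_le_mul hδle (le_trans (abs_add_le _ _) (add_le_add hsl hsr)) (abs_nonneg _) hu.le
      calc |(el + er) * (1 + δ) + δ * (SumTree.exact l + SumTree.exact r)|
          ≤ ((1 + α.unitRoundoff) ^ H - 1) * (Al + Ar) * (1 + α.unitRoundoff)
              + α.unitRoundoff * (Al + Ar) := le_trans (abs_add_le _ _) (add_le_add h1 h2)
        _ = ((1 + α.unitRoundoff) ^ (H + 1) - 1) * (Al + Ar) := by ring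

/-- `γ` form: with `h·u < 1`, `|ŝ - s| ≤ γ_h · Σ|xᵢ|`. [cite: Higham2002ASNA, §4.2 eq. (4.6)] -/
theorem abs_eval_sub_exact_le_gamma (hα : 2 ≤ α.emaxCode) (t : SumTree) (ht : TreeInRange α t)
    (hh : (treeHeight t : ℚ) * α.unitRoundoff < 1) :
    |SumTree.eval (flα α) t - SumTree.exact t|
      ≤ Higham2002.gamma α.unitRoundoff (treeHeight t) * absLeafSum t :=
  le_trans (abs_eval_sub_exact_le_height hα t ht)
    (mul_le_mul_of_nonneg_right
      (Higham2002.one_add_pow_sub_one_le_gamma α.unitRoundoff_pos.le hh) (absLeafSum_nonneg t))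

/-- PAIRWISE example (bfloat16, kernel): the balanced tree `((1 + u) + (u + u))` with `u = 2^-8`
evaluates to `1 + 1/128` — the inner `1 + u` ties to even (`↦ 1`), `u + u = 2u` is exact, and
`1 + 2u` is representable — whereas the exact sum is `1 + 3/256` (error `u`, within the height-2
bound `((1+u)² - 1)·Σ|xᵢ|`); sequentially the same summands give `1` (error `3u`, Accumulate.lean). -/
theorem pairwise_example_BFloat16 :
    SumTree.eval (flα Format.BFloat16)
      (.node (.node (.leaf 1) (.leaf (1/256))) (.node (.leaf (1/256)) (.leaf (1/256))))
      = 1 + 1 / 128 := by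
  decide +kernel

end MiniFloat

end Literature.ComputerArithmetic.FloatingPoint
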